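import Literature.NumberTheory.ComplexMultiplication.DadeTausskyZassenhausCubicUnits
import Literature.Topology.FourManifolds.CappellShanesonEisensteinSeven
import Mathlib.NumberTheory.NumberField.ClassNumber
import HarnessLib

/-!
# `ℤ[β]` is the maximal order of `ℚ(β)`, `β³ + 2β² + 2β + 2 = 0`; `d_K = −44`; class number `1`
# (two of the [LMFDB23] facts cited by Hertling–Larabi 2026b §8, PROVED), and Lemma 8.1 without its hypothesis

[topic NumberTheory/ComplexMultiplication] Lane `lit-hodgefound` (Track 2 foundations library), seat p19 generation 43,
row g43-#4.  Sequel of `DadeTausskyZassenhausCubicOrders` (p19 g41-#4: Lemma 8.1 WITH the hypothesis `Λ ⊆ Λ₁`,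
«`= Λ_max` by [LMFDB23], cited by HL») and `DadeTausskyZassenhausCubicUnits` (p19 g43-#2: unit rank `1`).  HL open
§8 with «First, we cite (and use without own proof) some facts which [LMFDB23] states on the algebraic number field
`A := ℚ[α]` and its maximal order `Λ_max`: […] `Λ_max = ℤ[γ]`, `Λ_max^{unit} = {±γ^l | l ∈ ℤ}`, `|G([Λ_max]_ε)| =
(class number of A) = 1`.»  This file PROVES the first and the third of these (`ℤ[γ] = ℤ[β]`, `β = γ − 1`):
`𝓞_K = ℤ[β]` because `t³ + 2t² + 2t + 2` is Eisenstein at `2` and `Δ = −44 = 2²·(−11)` (Marcus, Ch. 2 Thm. 9 and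
Ex. 27, Ch. 3 Ex. 3.20–3.22: `Δ·𝓞_K ⊆ ℤ[β]`, Eisenstein removes the `2²`, so the index divides `11³` and its square
divides `44`); hence `d_K = −44`, and the class number is `1` by the Minkowski bound (`44 < 81π²/16`, Mathlib
`RingOfIntegers.isPrincipalIdealRing_of_abs_discr_lt`).  Consequently LEMMA 8.1 holds as printed, for every order
(finitely generated multiplicatively closed lattice) `Λ ⊇ Λ₄`, the hypothesis `Λ ⊆ Λ₁` of the tree's version being
discharged.  Uses BY NAME the tree's `NumberTheory/NumberFields/IntegralBasisCriterion` (`indexDet`,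
`discr_powerBasis_eq_indexDet_sq_mul_discr`, `mem_adjoin_of_isUnit_indexDet`, `discr_eq_of_isUnit_indexDet`),
`CubicFieldConductor` (`MonicCubic.disc_mul_mem_adjoin`, `isEisensteinAt_poly`, `mem_adjoin_of_eisenstein`,
`exists_coords_of_mem_adjoin`) and `Topology/FourManifolds/CappellShanesonEisensteinSeven.indexDet_dvd_pow_of_smul_mem`
(the same argument for the Cappell–Shaneson cubics at `7`).  THEOREMS ONLY: no definition, no instance, no notation,
no named fact (D-0026, net Literature debt `0`), no `sorry`.

## Source, VERBATIM — C. Hertling, K. Larabi, *Conjugacy classes of regular integer matrices*, arXiv:2602.15748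
(2026) [HertlingLarabi2026b], held `paper:arxiv-2602.15748`, §8 «An irreducible rank 3 case», chunk p0024

«There `A = ℚ[α]` with `α` a zero of the irreducible polynomial `t³ + 4t² + 8t + 16` and `Λ₄ = ℤ[α] ⊂ A`. […]
First, we cite (and use without own proof) some facts which [LMFDB23] states on the algebraic number field
`A := ℚ[α]` and its maximal order `Λ_max` of algebraic integers: `A = ℚ[γ]` where `γ` is a zero of `t³ − t² + t + 1`,
`Λ_max = ℤ[γ] = ⟨1, γ, γ²⟩_ℤ`, `Λ_max^{unit} = {±γ^l | l ∈ ℤ}`, `|G([Λ_max]_ε)| = (class number of A) = 1`.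
Define `β := γ − 1`. Then `0 = β³ + 2β² + 2β + 2`, `α = 2β`, `Λ₁ := Λ_max = ℤ[β] = ⟨1, β, β²⟩_ℤ`, […]
`Λ₄ = ℤ[2β] = ⟨1, 2β, 4β²⟩_ℤ`.  Lemma 8.1. The only orders `Λ ⊃ Λ₄` are `Λ₁ = ⟨1, β, β²⟩_ℤ`, `Λ₂ = ⟨1, 2β, β²⟩_ℤ`,
`Λ₃ = ⟨1, 2β, 2β²⟩_ℤ`, `Λ₄ = ⟨1, 2β, 4β²⟩_ℤ`.»

## What is proved (`K` a number field of degree `3`, `θ ∈ K` with `θ³ + 2θ² + 2θ + 2 = 0`)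

* §1 `isEisensteinAt_two`, `disc_two_two_two` (`Δ = −44`).
* §2 **`isUnit_indexDet`**: the index determinant of `1, θ, θ²` in `𝓞 K` is `±1`.
* §3 **`mem_adjoin_theta`** (`𝓞_K = ℤ[θ]`), **`mem_span₁_of_isIntegral`** (every algebraic integer of `K` lies in
  `Λ₁ = ⟨1, θ, θ²⟩_ℤ`), **`discr_eq`** (`d_K = −44`).
* §4 `nrComplexPlaces_eq_one`, **`isPrincipalIdealRing_ringOfIntegers`**, **`classNumber_eq_one`**.
* §5 `le_span₁_of_isOrder` (every order lies in `Λ₁`), **`eq_of_isOrder`**: LEMMA 8.1 for every finitely generated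
  `Λ ⊇ Λ₄` with `Λ·Λ ⊆ Λ`.
NOT proved here: HL's second cited fact `Λ_max^{unit} = {±(β+1)^l}` (that `β + 1` is a FUNDAMENTAL unit); the
weaker `Λ₁^{unit} = ⟨−1, β+1⟩·(Λ₁^{unit})²` is `DadeTausskyZassenhausCubicUnits.unit_eq_sign_mul_pow_mul_sq`.

## References
* [HertlingLarabi2026b] C. Hertling, K. Larabi, arXiv:2602.15748, §8.
* [Marcus2018] D. A. Marcus, *Number Fields*, 2nd ed. (2018): Ch. 2, Thm. 9 and Exercise 27; Ch. 3, Exercises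
  3.20–3.22 (Eisenstein and the index); Ch. 5, Cor. 2 of Thm. 37 (Minkowski bound).
-/

noncomputable section

open Polynomial Module NumberField Submodule

namespace Literature.NumberTheory.ComplexMultiplication.FiniteQAlgebraLattice.DTZCubic

open Literature.NumberTheory.NumberFields Literature.Topology.FourManifolds

variable {K : Type*} [Field K] [NumberField K] {θ : K}

/-! ## §1 `t³ + 2t² + 2t + 2` is Eisenstein at `2`; its discriminant is `−44 = 2²·(−11)` -/

/-- `t³ + 2t² + 2t + 2` is `2`-Eisenstein. [cite: HertlingLarabi2026b, §8 («`0 = β³ + 2β² + 2β + 2`»), chunk p0024] -/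
theorem isEisensteinAt_two : (MonicCubic.poly 2 2 2).IsEisensteinAt (Ideal.span {((2 : ℕ) : ℤ)}) :=
  MonicCubic.isEisensteinAt_poly Nat.prime_two (by norm_num) (by norm_num) (by norm_num) (by norm_num)

/-- `Δ(t³ + 2t² + 2t + 2) = −44`. [cite: HertlingLarabi2026b, §8, chunk p0024] -/
theorem disc_two_two_two : MonicCubic.disc 2 2 2 = -44 := by
  norm_num [MonicCubic.disc]

/-! ## §2 The index of `ℤ[θ]` in `𝓞 K` is `1` -/

/-- Arithmetic: `d ∣ 11³` and `d² ∣ 44` force `d = ±1`. [folklore] -/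
private theorem isUnit_of_dvd_of_sq_dvd {d : ℤ} (hA : d ∣ 11 ^ 3) (hB : d ^ 2 ∣ 44) : IsUnit d := by
  have h11 : Nat.Prime 11 := by norm_num
  have hdvd : d.natAbs ∣ 11 ^ 3 := by
    have h := Int.natAbs_dvd_natAbs.2 hA
    simpa using h
  obtain ⟨i, -, hdi⟩ := (Nat.dvd_prime_pow h11).1 hdvd
  rcases Nat.eq_zero_or_pos i with rfl | hipos
  · rw [pow_zero] at hdi
    exact Int.isUnit_iff_natAbs_eq.2 hdi
  · exfalso
    have h11d : (11 : ℤ) ∣ d := by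
      have h : ((11 : ℕ) : ℤ) ∣ d := Int.natCast_dvd.2 (by rw [hdi]; exact dvd_pow_self 11 hipos.ne')
      exact_mod_cast h
    have h121 : (11 : ℤ) ^ 2 ∣ 44 := (pow_dvd_pow_of_dvd h11d 2).trans hB
    have := Int.le_of_dvd (by norm_num) h121
    norm_num at this

/-- **The index determinant of `1, θ, θ²` is a unit: `ℤ[θ]` has index `1` in `𝓞 K`** (`Δ·𝓞_K ⊆ ℤ[θ]` with
`Δ = −44 = 2²·(−11)`; Eisenstein at `2` removes `2²` (Mathlib `mem_adjoin_of_smul_prime_pow_smul_of_minpoly_isEisensteinAt`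
through the tree's `MonicCubic.mem_adjoin_of_eisenstein`), so `11·𝓞_K ⊆ ℤ[θ]`; hence the index `d` has `d ∣ 11³`
and `d² ∣ 44`). HL: «`Λ_max = ℤ[γ]`» (cited from [LMFDB23]; `ℤ[γ] = ℤ[β]`, `β = γ − 1`).
[cite: HertlingLarabi2026b, §8 («`Λ_max = ℤ[γ] = ⟨1, γ, γ²⟩_ℤ`», «`Λ₁ := Λ_max = ℤ[β]`»), chunk p0024] -/
theorem isUnit_indexDet (hθ : aeval θ (MonicCubic.poly 2 2 2) = 0) (h3 : finrank ℚ K = 3) :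
    IsUnit (indexDet (MonicCubic.pb irreducible_polyQ_two_two_two hθ h3)
      (MonicCubic.isIntegral_pb_gen irreducible_polyQ_two_two_two hθ h3)) := by
  have hirr := irreducible_polyQ_two_two_two
  set Bp := MonicCubic.pb hirr hθ h3 with hBp
  have hint := MonicCubic.isIntegral_pb_gen hirr hθ h3
  -- (1) `−44·x ∈ ℤ[θ]`, (2) Eisenstein at `2`: `11·x ∈ ℤ[θ]`
  have hmmem : ∀ x : 𝓞 K, (11 : K) * x ∈ Algebra.adjoin ℤ ({θ} : Set K) := by
    intro x
    have h44 := MonicCubic.disc_mul_mem_adjoin hirr hθ h3 x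
    rw [disc_two_two_two] at h44
    have hx : ((2 : ℕ) : K) ^ 2 * ((((-11 : 𝓞 K) * x : 𝓞 K)) : K) ∈ Algebra.adjoin ℤ ({θ} : Set K) := by
      have e : ((2 : ℕ) : K) ^ 2 * ((((-11 : 𝓞 K) * x : 𝓞 K)) : K) = ((-44 : ℤ) : K) * (x : K) := by
        simp only [map_mul, map_neg, map_ofNat]
        push_cast
        ring
      rw [e]
      exact h44
    have hθ' : aeval (θ - ((0 : ℤ) : K)) (MonicCubic.poly 2 2 2) = 0 := by simpa using hθ
    have h := MonicCubic.mem_adjoin_of_eisenstein h3 hirr hθ' Nat.prime_two isEisensteinAt_two hx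
    have e2 : ((((-11 : 𝓞 K) * x : 𝓞 K)) : K) = -((11 : K) * x) := by
      simp only [map_mul, map_neg, map_ofNat, neg_mul]
    rw [e2] at h
    have h' := neg_mem h
    rwa [neg_neg] at h'
  -- (3) `11 • x ∈ span(1, θ, θ²)` inside `𝓞 K`
  have hdim : Bp.dim = 3 := MonicCubic.pb_dim hirr hθ h3
  let j0 : Fin Bp.dim := ⟨0, by omega⟩
  let j1 : Fin Bp.dim := ⟨1, by omega⟩
  let j2 : Fin Bp.dim := ⟨2, by omega⟩
  have hpow : ∀ j : Fin Bp.dim, ((powInt Bp hint j : 𝓞 K) : K) = θ ^ (j : ℕ) := fun j => by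
    rw [coe_powInt, Bp.coe_basis]
    rfl
  have hspan : ∀ x : 𝓞 K, (11 : ℤ) • x ∈ Submodule.span ℤ (Set.range (powInt Bp hint)) := by
    intro x
    obtain ⟨u, v, w, huvw⟩ := MonicCubic.exists_coords_of_mem_adjoin hθ (hmmem x)
    have heq : (11 : ℤ) • x = u • powInt Bp hint j0 + v • powInt Bp hint j1 + w • powInt Bp hint j2 := by
      apply IsFractionRing.injective (𝓞 K) K
      simp only [map_add, zsmul_eq_mul]
      change ((11 : ℤ) : K) * (x : K) = (u : K) * ((powInt Bp hint j0 : 𝓞 K) : K) +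
        (v : K) * ((powInt Bp hint j1 : 𝓞 K) : K) + (w : K) * ((powInt Bp hint j2 : 𝓞 K) : K)
      rw [hpow, hpow, hpow]
      push_cast
      rw [huvw]
      simp [j0, j1, j2]
    rw [heq]
    refine Submodule.add_mem _ (Submodule.add_mem _ ?_ ?_) ?_ <;>
      exact Submodule.smul_mem _ _ (Submodule.subset_span ⟨_, rfl⟩)
  -- (4) `d ∣ 11³`, `d² ∣ 44`
  have hA : indexDet Bp hint ∣ (11 : ℤ) ^ 3 := by
    have := indexDet_dvd_pow_of_smul_mem Bp hint _ hspan
    rwa [hdim] at this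
  have hB : indexDet Bp hint ^ 2 ∣ 44 := by
    have key := (MonicCubic.discr_pb hirr hθ h3).symm.trans (discr_powerBasis_eq_indexDet_sq_mul_discr Bp hint)
    rw [disc_two_two_two] at key
    refine ⟨-NumberField.discr K, ?_⟩
    have : (indexDet Bp hint : ℤ) ^ 2 * NumberField.discr K = -44 := by
      exact_mod_cast key.symm
    linear_combination this
  exact isUnit_of_dvd_of_sq_dvd hA hB

/-! ## §3 `𝓞 K = ℤ[θ] = Λ₁` and `d_K = −44` -/

/-- **`𝓞_K = ℤ[β]`**: every algebraic integer of `K = ℚ(β)` lies in `ℤ[β]` — HL's «`Λ_max = ℤ[γ]`» ([LMFDB23]),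
proved. [cite: HertlingLarabi2026b, §8 («`Λ₁ := Λ_max = ℤ[β] = ⟨1, β, β²⟩_ℤ`»), chunk p0024] -/
theorem mem_adjoin_theta (hθ : aeval θ (MonicCubic.poly 2 2 2) = 0) (h3 : finrank ℚ K = 3) (x : 𝓞 K) :
    (x : K) ∈ Algebra.adjoin ℤ ({θ} : Set K) :=
  mem_adjoin_of_isUnit_indexDet _ _ (isUnit_indexDet hθ h3) x

/-- **`Λ_max = Λ₁ = ⟨1, β, β²⟩_ℤ`**: every algebraic integer of `K` has integer coordinates on `1, β, β²`.
[cite: HertlingLarabi2026b, §8 («`Λ_max = ⟨1, γ, γ²⟩_ℤ`», «`Λ₁ = ⟨1, β, β²⟩_ℤ`»), chunk p0024] -/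
theorem mem_span₁_of_isIntegral (hθ : aeval θ (MonicCubic.poly 2 2 2) = 0) (h3 : finrank ℚ K = 3) {z : K}
    (hz : IsIntegral ℤ z) : z ∈ span ℤ ({1, θ, θ ^ 2} : Set K) := by
  have h : z ∈ Algebra.adjoin ℤ ({θ} : Set K) :=
    mem_adjoin_theta hθ h3 ⟨z, hz⟩
  obtain ⟨u, v, w, huvw⟩ := MonicCubic.exists_coords_of_mem_adjoin hθ h
  rw [huvw]
  exact mem_span_triple.2 ⟨u, v, w, by simp only [zsmul_eq_mul, mul_one]⟩

/-- **`d_K = −44`** for `K = ℚ(β)`. [cite: HertlingLarabi2026b, §8 (the field `A = ℚ[α] = ℚ[γ]`, `γ³ − γ² + γ + 1 = 0`), chunk p0024] -/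
theorem discr_eq (hθ : aeval θ (MonicCubic.poly 2 2 2) = 0) (h3 : finrank ℚ K = 3) :
    NumberField.discr K = -44 := by
  have h := discr_eq_of_isUnit_indexDet _ _ (isUnit_indexDet hθ h3) (MonicCubic.disc 2 2 2)
    (MonicCubic.discr_pb irreducible_polyQ_two_two_two hθ h3)
  rw [h, disc_two_two_two]

/-! ## §4 Class number one -/

/-- `K` has one complex place. [cite: HertlingLarabi2026b, §8, chunk p0024] -/
theorem nrComplexPlaces_eq_one (hθ : aeval θ (MonicCubic.poly 2 2 2) = 0) (h3 : finrank ℚ K = 3) :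
    NumberField.InfinitePlace.nrComplexPlaces K = 1 := by
  have hrank := units_rank_eq_one hθ h3
  have h1 := NumberField.InfinitePlace.card_add_two_mul_card_eq_rank K
  have h2 := NumberField.InfinitePlace.card_eq_nrRealPlaces_add_nrComplexPlaces K
  have hpos : 0 < Fintype.card (NumberField.InfinitePlace K) := Fintype.card_pos
  rw [h3] at h1
  rw [NumberField.Units.rank] at hrank
  omega

/-- **The class number of `K = ℚ(β)` is `1`** (Minkowski: `|d_K| = 44 < (2·(π/4)·27/6)² = 81π²/16`; this is HL's
«`|G([Λ_max]_ε)| = (class number of A) = 1`», cited from [LMFDB23], proved).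
[cite: HertlingLarabi2026b, §8 («`|G([Λ_max]_ε)| = (class number of A) = 1`»), chunk p0024] -/
theorem isPrincipalIdealRing_ringOfIntegers (hθ : aeval θ (MonicCubic.poly 2 2 2) = 0) (h3 : finrank ℚ K = 3) :
    IsPrincipalIdealRing (𝓞 K) := by
  apply RingOfIntegers.isPrincipalIdealRing_of_abs_discr_lt
  rw [discr_eq hθ h3, nrComplexPlaces_eq_one hθ h3, h3]
  have hπ := Real.pi_gt_three
  push_cast
  norm_num
  nlinarith [hπ, Real.pi_pos]

/-- The class number of `K` is `1`. [cite: HertlingLarabi2026b, §8 («(class number of A) = 1»), chunk p0024] -/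
theorem classNumber_eq_one (hθ : aeval θ (MonicCubic.poly 2 2 2) = 0) (h3 : finrank ℚ K = 3) :
    NumberField.classNumber K = 1 :=
  (NumberField.classNumber_eq_one_iff).2 (isPrincipalIdealRing_ringOfIntegers hθ h3)

/-! ## §5 Lemma 8.1 without the hypothesis `Λ ⊆ Λ₁`: orders are contained in `Λ_max = Λ₁` -/

/-- **Every order of `K` lies in `Λ₁ = ℤ[β]`**: a finitely generated multiplicatively closed `ℤ`-submodule `Λ ∋ 1`
consists of algebraic integers (`isIntegral_of_smul_mem_submodule`), hence `Λ ⊆ 𝓞_K = Λ₁`.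
[cite: HertlingLarabi2026b, §8 («`Λ₁ := Λ_max`»), chunk p0024] -/
theorem le_span₁_of_isOrder (hθ : aeval θ (MonicCubic.poly 2 2 2) = 0) (h3 : finrank ℚ K = 3)
    {Λ : Submodule ℤ K} (hfg : Λ.FG) (h1 : (1 : K) ∈ Λ) (hmul : Λ * Λ ≤ Λ) :
    Λ ≤ span ℤ ({1, θ, θ ^ 2} : Set K) := by
  intro x hx
  have hne : Λ ≠ ⊥ := by
    intro h
    rw [h] at h1
    exact one_ne_zero ((Submodule.mem_bot ℤ).1 h1)
  have hint : IsIntegral ℤ x :=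
    isIntegral_of_smul_mem_submodule Λ hne hfg x fun n hn => hmul (Submodule.mul_mem_mul hx hn)
  exact mem_span₁_of_isIntegral hθ h3 hint

/-- **LEMMA 8.1 (unconditionally): the only orders `Λ ⊇ Λ₄ = ℤ[2β]` are `Λ₁, Λ₂, Λ₃, Λ₄`.**  HL prove this
using `Λ ⊆ Λ₁ = Λ_max` from [LMFDB23] (the tree's `eq_of_isOrder_adjoinRoot` carries `Λ ⊆ Λ₁` as a hypothesis);
here `Λ_max = Λ₁` is §3, so the hypothesis is discharged for every finitely generated `Λ`.
[cite: HertlingLarabi2026b, §8 Lemma 8.1, chunk p0024] -/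
theorem eq_of_isOrder (hθ : aeval θ (MonicCubic.poly 2 2 2) = 0) (h3 : finrank ℚ K = 3)
    {Λ : Submodule ℤ K} (hfg : Λ.FG)
    (h₄ : span ℤ ({1, 2 * θ, 4 * θ ^ 2} : Set K) ≤ Λ) (hmul : Λ * Λ ≤ Λ) :
    Λ = span ℤ ({1, θ, θ ^ 2} : Set K) ∨ Λ = span ℤ ({1, 2 * θ, θ ^ 2} : Set K) ∨
      Λ = span ℤ ({1, 2 * θ, 2 * θ ^ 2} : Set K) ∨ Λ = span ℤ ({1, 2 * θ, 4 * θ ^ 2} : Set K) :=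
  eq_of_isOrder_of_le_of_le (theta_rel_two hθ) h₄
    (le_span₁_of_isOrder hθ h3 hfg (h₄ (one_mem_span₄ θ)) hmul) hmul

end Literature.NumberTheory.ComplexMultiplication.FiniteQAlgebraLattice.DTZCubic
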